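import Literature.MathematicalPhysics.QuantumFieldTheory.Balaban1983to89.B15TreeGaugeT0Var
import Literature.MathematicalPhysics.QuantumFieldTheory.Balaban1983to89.B15TreeGaugeT0Bridge

/-!
# `Balaban1983to89.B15Claim196T0Var` — T. Bałaban, *Large field renormalization. I. The basic step of the 𝐑 operation*, Commun. Math. Phys. **122** (1989) 175–202 [Balaban1989LargeFieldI], p. 196: *"The regularity conditions for V″, V₀, and the gauge fixing for V′ introduce restrictions on this field. We can prove that it satisfies |V′ − 1| < O(1)M²NR_k⁴ε_k on 𝐁₀"* — PROVED (single-scale model) for the tree `T₀` with ONE THRESHOLD PER PAIR, i.e. for r12's `B15TreeGraph196.T0 lo hi τs m` AS TYPED (any admissible threshold sequence `τs : ℕ → ℤ`), with the two typings of the gauge fixing on `T₀` proved EQUIVALENT; the common-threshold model of `B15Claim196T0` (generation 5) is the constant sequence (seat p26, Phase-2 continuation of row **B15.Claim@196**; PART 8b)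

statement-level skeleton of published theorems with citation tags; proofs where landed; nothing here is a claim about the Yang–Mills mass gap

PDF held: `paper:balaban1989-cmp122-large-field-i` (journal page = PDF page + 174; pp. 195–196 = PDF pp. 21–22, text layer re-read by this
seat 2026-08-21).

WHAT IS REPRODUCED (mega-formalization `lit-balaban`, HOME `run/shared/lean/pub/lit-balaban/`, Phase-2 seat p26, generation 7;
SKELETON rows **B15.Claim@196** (r12 leaf `B15.PrelimIntegrations.IneqV196`, typed p239014, no proof in print) and **B15.Def@196**),
continuing `B15TreeGaugeT0Var` (PART 8a: `ChainGeomV`, `t0GaugeFnV`, the core estimate `T0HypV.norm_gauge_bond_sub_one_le`).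
  §4 the gauge conditions `T0GaugeV` (p. 196 *"We fix the gauge putting the bond variables equal to 1 for bonds belonging to the tree
graph"*: `V′ = 1` along every contour of threshold `τs i` of layer `i` and on the external bonds), `RegHypT0V` = p. 196's
*"regularity conditions for V″, V₀, and the gauge fixing for V′"*, and the CLAIM: **`RegHypT0V.norm_fluct_sub_one_le`** `‖V′(b) − 1‖
≤ ((d² + 12)W² + dW)(ε″ + ε₀)` for every bond with both ends in `𝐁₀`, `norm_fluct_sub_one_lt` (`< (d² + 13)D²(ε″ + ε₀)`, `D ≥ W + 1`
sites per side), **`RegHypT0V.ineqV196`** = the typed leaf `B15.PrelimIntegrations.IneqV196 ‖V′(b) − 1‖ (10⁴(d² + 13)K) M N R_k ε_k`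
BY NAME; the constant sequence recovers generation 5's hypotheses (`t0GaugeV_const_iff`, `RegHypT0.regHypT0V`).  §5 the DICTIONARY
to r12's tree for a general threshold sequence: `wordBonds_t0word_subset_T0V` (every bond of a `T₀`-path is a bond of `T0 lo hi τs
m`), **`T0GaugeV.of_eq_one_on_T0`** (`V′ = 1` on the bonds of r12's `T0 lo hi τs m` ⇒ `T0GaugeV`), and conversely
**`T0GaugeV.eq_one_on_T0`** (`T0GaugeV` + `V′ = 1` on the additional bond `⟨y⁰ − e₁, y⁰⟩` of `Λ` ⇒ `V′ = 1` on every bond of `T0 lo hi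
τs m`): the two typings of *"bond variables equal to 1 for bonds belonging to the tree graph"* are EQUIVALENT.  §6 the claim stated
directly over r12's tree: **`norm_fluct_sub_one_le_of_eq_one_on_T0`**, **`ineqV196_of_eq_one_on_T0`** (hypothesis `∀ b ∈ T0 lo hi τs
m, V′ b = 1`).  §7 (v1.1) the TREE CERTIFICATE for the model instance: the model's chains ARE r12's chains (`Geom.adm`,
**`ChainGeomV.chain`** `: ChainGeomV lo hi τs m → B15TreeGraph196.Chain m lo hi τs`), hence p. 196 *"It is a tree graph in 𝔹₀"* holds
for them by r12's theorem — **`ChainGeomV.T0_isTree`**, `card_T0`, `card_T0_eq` (one bond of `T₀` per site of `𝐁₀`) — and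
`mem_sites_iff` (the vertex set of r12's `T₀` is `𝐁₀ ∪ {y⁰ − e₁}` in the model's vocabulary), and (v1.2) **`ChainGeomV.mem_T0_iff`**:
r12's `T₀` is COVERED EXACTLY by the `T₀`-paths — a bond is in `T0 lo hi τs m` iff it is the `Λ`-bond `⟨y⁰ − e₁, y⁰⟩` or is traversed
by the `T₀`-path of some site of some layer (generation 5's dictionary proved only `⊆`).

HONEST SCOPE / DEVIATIONS (as generation 5 except for the thresholds).  (1) SINGLE SCALE: the chain is read on ONE unit lattice (as
r12 `B15TreeGraph196` §8); in print consecutive layers live on lattices of different spacing (reading (b) of G-B15-p26-03 remains).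
(2) `U1 𝔸`-valued fields (`⊇ U(N)`), `≤ ε` plaquette hypotheses on the plaquettes with four corners in `𝐁₀ = Λ∖Pᵐ` (p. 196
*"regularity conditions for V″, V₀"*, plaquettes only), explicit constant `(d² + 12)W² + dW`, `d = n + 3 ≥ 3` needed; the chain
geometry `ChainGeomV` asks STRICT nesting in every direction (print: margins of several `M`-cube layers, p. 179), which is stronger
than r12's `Chain`/`Adm` — the model instance is for chains with this geometry, the tree `T0 lo hi τs m` itself is r12's verbatim.
(3) The print states the claim without proof; the packaging `ε″ + ε₀ ≤ K·N·R_k²·ε_k`, `D = 100MR_k` (condition (i) p. 177) is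
generation 4's.  Every declaration is a definition with a body or a proved theorem; nothing of [IV] is asserted as a hypothesis-free
fact beyond what is proved.  Unit `lit-balaban-p26` (literature-prover-lit-balaban-p26-g7-0).
-/

noncomputable section

open scoped BigOperators

namespace Literature.MathematicalPhysics.QuantumFieldTheory.Balaban1983to89.B15TreeGauge196

open B7Prop1Explicit B8Lemma1NonAbelian B16Ineq382
open B15TreeGauge196Bridge (bondOf wordBonds wordBonds_nil wordBonds_cons wordBonds_append wordBonds_contour)

variable {n : ℕ}

/-! ## §4 The gauge conditions of `T₀` with one threshold per pair, and the claim of p. 196 -/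

section TreeConditions

variable {lo hi : ℕ → Site (n + 3)} {τs : ℕ → ℤ} {τ : ℤ} {m : ℕ} {G : Type*} [Group G]

/-- **p. 196: "We fix the gauge putting the bond variables equal to 1 for bonds belonging to the tree graph"**, for the `T₀` with one
threshold per pair: `V′ = 1` along every contour `Γ^{i}_{yⁱ,x}` OF THRESHOLD `τs i` of every layer `i`, and on the external bonds
`⟨yⁱ⁺¹ − e₁, yⁱ⁺¹⟩` of the inner domains `Pⁱ⁺¹`, `i + 1 < m`. [cite: Balaban1989LargeFieldI, p.196] -/
structure T0GaugeV (V' : Site (n + 3) → Fin (n + 3) → G) (lo hi : ℕ → Site (n + 3)) (τs : ℕ → ℤ) (m : ℕ) : Prop where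
  tree : ∀ i, i < m → ∀ x ∈ layer lo hi i, BondsOneAlong V' (lo i) (contour (lo i) (hi i) (τs i) x)
  ext : ∀ i, i + 1 < m → V' (lo (i + 1) - e i0) i0 = 1

variable {V' V₀ : Site (n + 3) → Fin (n + 3) → G}

/-- Generation 5's gauge conditions are the constant-sequence case. [cite: Balaban1989LargeFieldI, p.196] -/
theorem t0GaugeV_const_iff : T0GaugeV V' lo hi (fun _ => τ) m ↔ T0Gauge V' lo hi τ m :=
  ⟨fun h => ⟨h.tree, h.ext⟩, fun h => ⟨h.tree, h.ext⟩⟩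

/-- The gauge conditions hold along the chain words (these pass through usual contours and external bonds only, whatever the
thresholds). [cite: Balaban1989LargeFieldI, p.196] -/
theorem T0GaugeV.bondsOneAlong_chainWord (hT : T0GaugeV V' lo hi τs m) (hC : ChainGeomV lo hi τs m) :
    ∀ {i : ℕ}, i < m → BondsOneAlong V' (lo 0) (chainWord lo i)
  | 0, _ => bondsOneAlong_nil
  | i + 1, him => by
    have him' : i < m := by omega
    rw [chainWord_succ_eq (hC.chainGeom him') (Nat.lt_succ_self i), bondsOneAlong_append, add_disp_chainWord,
      bondsOneAlong_append, bondsOneAlong_cons, disp_contour,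
      show lo i + (lo (i + 1) - e i0 - lo i) = lo (i + 1) - e i0 by abel, stepHol_true]
    exact ⟨hT.bondsOneAlong_chainWord hC him',
      hT.tree i him' _ ((hC.chainGeom him').extEnd_mem_layer le_rfl), hT.ext i him, bondsOneAlong_nil⟩

/-- **The gauge conditions hold along every `T₀`-path.** [cite: Balaban1989LargeFieldI, p.196] -/
theorem T0GaugeV.bondsOneAlong_t0word (hT : T0GaugeV V' lo hi τs m) (hC : ChainGeomV lo hi τs m) {i : ℕ} (him : i < m)
    {x : Site (n + 3)} (hx : x ∈ layer lo hi i) : BondsOneAlong V' (lo 0) (t0word lo hi (τs i) i x) := by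
  rw [t0word, bondsOneAlong_append, add_disp_chainWord]
  exact ⟨hT.bondsOneAlong_chainWord hC him, hT.tree i him x hx⟩

/-- **[V] p. 381: "v is determined by V₀ only, because V′ satisfies the conditions"** — on `𝐁₀` the gauge function built from `V″
= V′V₀` ((1.81)) is the one built from `V₀`. [cite: Balaban1989LargeFieldI, p.196] -/
theorem T0GaugeV.t0GaugeFnV_mulCfg (hT : T0GaugeV V' lo hi τs m) (hC : ChainGeomV lo hi τs m) {i : ℕ} (him : i < m)
    {x : Site (n + 3)} (hx : x ∈ layer lo hi i) : t0GaugeFnV (mulCfg V' V₀) lo hi τs x = t0GaugeFnV V₀ lo hi τs x := by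
  rw [hC.t0GaugeFnV_eq_hol _ him hx, hC.t0GaugeFnV_eq_hol _ him hx,
    hol_mulCfg_eq_of_bondsOneAlong (hT.bondsOneAlong_t0word hC him hx)]

end TreeConditions

section Claim

variable {𝔸 : Type*} [NormedRing 𝔸] [NormOneClass 𝔸]

/-- **[IV] p. 196: "The regularity conditions for V″, V₀, and the gauge fixing for V′"** on the chain `Λ = P⁰ ⊃ ⋯ ⊃ Pᵐ` with ONE
THRESHOLD PER PAIR, in the variables of (1.81) `V″ = V′V₀`: the chain geometry `ChainGeomV`, sides of `Λ` of at most `W + 1`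
sites, `U1`-valued `V′`, `V₀`; the plaquettes of `V″ = V′V₀` with corners in `𝐁₀` deviate from `1` by `≤ ε″` and those of `V₀` by
`≤ ε₀`; and the tree gauge `T₀`: `V′ = 1` along every contour (of the pair's own threshold) of every layer and on the external
bonds. [cite: Balaban1989LargeFieldI, p.196 (bound on V′)] -/
structure RegHypT0V (lo hi : ℕ → Site (n + 3)) (τs : ℕ → ℤ) (m W : ℕ) (V' V₀ : Site (n + 3) → Fin (n + 3) → 𝔸ˣ)
    (ε'' ε₀ : ℝ) : Prop where
  chain : ChainGeomV lo hi τs m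
  width : ∀ κ, hi 0 κ - lo 0 κ ≤ W
  unit' : ∀ x κ, V' x κ ∈ U1 𝔸
  unit₀ : ∀ x κ, V₀ x κ ∈ U1 𝔸
  eps''_nonneg : 0 ≤ ε''
  eps₀_nonneg : 0 ≤ ε₀
  plaq'' : B16Ineq382.PlaqSmallOn (B0 lo hi m) (mulCfg V' V₀) ε''
  plaq₀ : B16Ineq382.PlaqSmallOn (B0 lo hi m) V₀ ε₀
  tree : T0GaugeV V' lo hi τs m

variable {lo hi : ℕ → Site (n + 3)} {τs : ℕ → ℤ} {τ : ℤ} {m W : ℕ} {V' V₀ : Site (n + 3) → Fin (n + 3) → 𝔸ˣ} {ε'' ε₀ : ℝ}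

/-- Generation 5's hypotheses are the constant-sequence case. [cite: Balaban1989LargeFieldI, p.196 (bound on V′)] -/
theorem RegHypT0.regHypT0V (H : RegHypT0 lo hi τ m W V' V₀ ε'' ε₀) : RegHypT0V lo hi (fun _ => τ) m W V' V₀ ε'' ε₀ :=
  ⟨H.chain.chainGeomV, H.width, H.unit', H.unit₀, H.eps''_nonneg, H.eps₀_nonneg, H.plaq'', H.plaq₀,
    t0GaugeV_const_iff.mpr H.tree⟩

/-- `V″ = V′V₀` satisfies §3's hypotheses with `ε″`. [cite: Balaban1989LargeFieldI, p.196 (bound on V′)] -/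
theorem RegHypT0V.t0Hyp'' (H : RegHypT0V lo hi τs m W V' V₀ ε'' ε₀) : T0HypV lo hi τs m W (mulCfg V' V₀) ε'' :=
  ⟨H.chain, H.width, mulCfg_mem H.unit' H.unit₀, H.eps''_nonneg, H.plaq''⟩

/-- `V₀` satisfies §3's hypotheses with `ε₀`. [cite: Balaban1989LargeFieldI, p.196 (bound on V′)] -/
theorem RegHypT0V.t0Hyp₀ (H : RegHypT0V lo hi τs m W V' V₀ ε'' ε₀) : T0HypV lo hi τs m W V₀ ε₀ :=
  ⟨H.chain, H.width, H.unit₀, H.eps₀_nonneg, H.plaq₀⟩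

/-- **[IV] p. 196, the claim "|V′ − 1| < O(1)M²NR_k⁴ε_k on 𝐁₀", object level on ALL of `𝐁₀`, ONE THRESHOLD PER PAIR** (single-scale
model, explicit constant): in the situation `RegHypT0V`, every bond `b = ⟨x, x + e_μ⟩` with both ends in `𝐁₀` satisfies `‖V′(b) −
1‖ ≤ ((d² + 12)W² + dW)(ε″ + ε₀)`.  Proof: `V′(b) = v(x)⁻¹·[(V′V₀)^v(b)·(V₀^v(b))⁻¹]·v(x)` (`fluct_eq_conj`) with `v` the `T₀` gauge
function of `V₀`, which on `𝐁₀` is also that of `V″ = V′V₀` (`T0GaugeV.t0GaugeFnV_mulCfg`); both gauge-fixed factors are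
controlled by §3. [cite: Balaban1989LargeFieldI, p.196 (bound on V′)] -/
theorem RegHypT0V.norm_fluct_sub_one_le (H : RegHypT0V lo hi τs m W V' V₀ ε'' ε₀) {x : Site (n + 3)} {μ : Fin (n + 3)}
    (hx : x ∈ B0 lo hi m) (hx' : x + e μ ∈ B0 lo hi m) :
    ‖((V' x μ : 𝔸ˣ) : 𝔸) - 1‖ ≤ ((((n : ℝ) + 3) ^ 2 + 12) * (W : ℝ) ^ 2 + (n + 3) * W) * (ε'' + ε₀) := by
  obtain ⟨i, him, hxi⟩ := hx
  obtain ⟨j, hjm, hxj⟩ := hx'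
  set v := t0GaugeFnV V₀ lo hi τs with hv
  have hvx : v x ∈ U1 𝔸 := hol_mem H.unit₀ _ _
  set A := gaugeAct v (mulCfg V' V₀) x μ with hA
  set B := gaugeAct v V₀ x μ with hB
  -- `A` is the bond variable of `V″` in ITS `T₀` gauge (the two gauge functions agree at `x` and `x + e_μ`)
  have hAeq : A = gaugeAct (t0GaugeFnV (mulCfg V' V₀) lo hi τs) (mulCfg V' V₀) x μ := by
    simp only [hA, gaugeAct, hv, H.tree.t0GaugeFnV_mulCfg H.chain him hxi, H.tree.t0GaugeFnV_mulCfg H.chain hjm hxj]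
  have hAle : ‖(A : 𝔸) - 1‖ ≤ ((((n : ℝ) + 3) ^ 2 + 12) * (W : ℝ) ^ 2 + (n + 3) * W) * ε'' := by
    rw [hAeq]; exact H.t0Hyp''.norm_gauge_bond_sub_one_le him hjm hxi hxj
  have hBle : ‖(B : 𝔸) - 1‖ ≤ ((((n : ℝ) + 3) ^ 2 + 12) * (W : ℝ) ^ 2 + (n + 3) * W) * ε₀ :=
    H.t0Hyp₀.norm_gauge_bond_sub_one_le him hjm hxi hxj
  have hAU : A ∈ U1 𝔸 := gaugeAct_mem (mulCfg_mem H.unit' H.unit₀) (fun _ => hol_mem H.unit₀ _ _) x μ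
  have hBU : B ∈ U1 𝔸 := gaugeAct_mem H.unit₀ (fun _ => hol_mem H.unit₀ _ _) x μ
  have hBinv : ‖((B⁻¹ : 𝔸ˣ) : 𝔸) - 1‖ ≤ ‖(B : 𝔸) - 1‖ := norm_inv_sub_one_le hBU
  have hAB : ‖((A * B⁻¹ : 𝔸ˣ) : 𝔸) - 1‖ ≤ ‖(A : 𝔸) - 1‖ + ‖((B⁻¹ : 𝔸ˣ) : 𝔸) - 1‖ := norm_units_mul_sub_one_le hAU
  have hconj : ‖(((v x)⁻¹ : 𝔸ˣ) : 𝔸) * ((A * B⁻¹ : 𝔸ˣ) : 𝔸) * ((v x : 𝔸ˣ) : 𝔸) - 1‖ ≤ ‖((A * B⁻¹ : 𝔸ˣ) : 𝔸) - 1‖ :=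
    norm_units_inv_conj_sub_one_le hvx _
  have heq : ((V' x μ : 𝔸ˣ) : 𝔸) = (((v x)⁻¹ : 𝔸ˣ) : 𝔸) * ((A * B⁻¹ : 𝔸ˣ) : 𝔸) * ((v x : 𝔸ˣ) : 𝔸) := by
    rw [← Units.val_mul, ← Units.val_mul, ← fluct_eq_conj v V' V₀ x μ]
  rw [heq]
  have hsum : ((((n : ℝ) + 3) ^ 2 + 12) * (W : ℝ) ^ 2 + (n + 3) * W) * ε'' +
      ((((n : ℝ) + 3) ^ 2 + 12) * (W : ℝ) ^ 2 + (n + 3) * W) * ε₀ =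
      ((((n : ℝ) + 3) ^ 2 + 12) * (W : ℝ) ^ 2 + (n + 3) * W) * (ε'' + ε₀) := by ring
  linarith

/-- **Printed-style strict shape**: with `D ≥ W + 1` sites per side (condition (i) of p. 177: `D = 100MR_k`), `d ≤ D` and
`0 < ε″ + ε₀`, every bond of `𝐁₀` has `‖V′(b) − 1‖ < (d² + 13)D²(ε″ + ε₀)`. [cite: Balaban1989LargeFieldI, p.196 (bound on V′)] -/
theorem RegHypT0V.norm_fluct_sub_one_lt (H : RegHypT0V lo hi τs m W V' V₀ ε'' ε₀) {D : ℝ} (hD : (W : ℝ) + 1 ≤ D)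
    (hd : (n : ℝ) + 3 ≤ D) (hε : 0 < ε'' + ε₀) {x : Site (n + 3)} {μ : Fin (n + 3)} (hx : x ∈ B0 lo hi m)
    (hx' : x + e μ ∈ B0 lo hi m) :
    ‖((V' x μ : 𝔸ˣ) : 𝔸) - 1‖ < (((n : ℝ) + 3) ^ 2 + 13) * D ^ 2 * (ε'' + ε₀) := by
  refine (H.norm_fluct_sub_one_le hx hx').trans_lt (mul_lt_mul_of_pos_right ?_ hε)
  have hW : (0 : ℝ) ≤ W := Nat.cast_nonneg W
  have hn : (0 : ℝ) ≤ n := Nat.cast_nonneg n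
  have hD0 : (0 : ℝ) ≤ D := by linarith
  have h1 : (W : ℝ) * W < D * D := by nlinarith
  have h2 : ((n : ℝ) + 3) * W ≤ D * D := mul_le_mul hd (by linarith) hW hD0
  have h3 : 0 ≤ ((n : ℝ) + 3) ^ 2 + 12 := by positivity
  nlinarith [mul_le_mul_of_nonneg_left h1.le h3, h1, h2]

/-- **The row's typed leaf, discharged by name on all of `𝐁₀`, one threshold per pair** (single-scale model): with `D = 100·M·R_k`
sites per side (p. 177 (i): *"it is contained in a cube of the size 100MR_k"*), `d ≤ 100MR_k`, and the two regularity inputs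
packaged as `ε″ + ε₀ ≤ K·N·R_k²·ε_k` (`0 < K`, `N ≥ 1`, `R_k, ε_k > 0`), every bond `b` with both ends in `𝐁₀` satisfies
`B15.PrelimIntegrations.IneqV196 ‖V′(b) − 1‖ (10⁴(d² + 13)K) M N R_k ε_k`, i.e. the printed `|V′(b) − 1| < O(1)M²NR_k⁴ε_k` with
`O(1) = 10⁴(d² + 13)K`. [cite: Balaban1989LargeFieldI, p.196 (bound on V′)] -/
theorem RegHypT0V.ineqV196 (H : RegHypT0V lo hi τs m W V' V₀ ε'' ε₀) {M Rk N εk K : ℝ}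
    (hD : (W : ℝ) + 1 ≤ 100 * M * Rk) (hd : (n : ℝ) + 3 ≤ 100 * M * Rk) (hK : 0 < K) (hN : 1 ≤ N) (hRk : 0 < Rk)
    (hεk : 0 < εk) (hreg : ε'' + ε₀ ≤ K * N * Rk ^ 2 * εk) {x : Site (n + 3)} {μ : Fin (n + 3)}
    (hx : x ∈ B0 lo hi m) (hx' : x + e μ ∈ B0 lo hi m) :
    B15.PrelimIntegrations.IneqV196 ‖((V' x μ : 𝔸ˣ) : 𝔸) - 1‖ (10000 * (((n : ℝ) + 3) ^ 2 + 13) * K) M N Rk εk := by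
  unfold B15.PrelimIntegrations.IneqV196
  have hle := H.norm_fluct_sub_one_le hx hx'
  have hW : (0 : ℝ) ≤ W := Nat.cast_nonneg W
  have hn : (0 : ℝ) ≤ n := Nat.cast_nonneg n
  set D : ℝ := 100 * M * Rk with hDdef
  have hD0 : (0 : ℝ) ≤ D := by linarith
  have h1 : (W : ℝ) * W < D * D := by nlinarith
  have h2 : ((n : ℝ) + 3) * W ≤ D * D := mul_le_mul hd (by linarith) hW hD0
  have h3 : 0 ≤ ((n : ℝ) + 3) ^ 2 + 12 := by positivity
  have hcoef : (((n : ℝ) + 3) ^ 2 + 12) * (W : ℝ) ^ 2 + (n + 3) * W < (((n : ℝ) + 3) ^ 2 + 13) * D ^ 2 := by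
    nlinarith [mul_le_mul_of_nonneg_left h1.le h3, h1, h2]
  have hpos : 0 < K * N * Rk ^ 2 * εk := by positivity
  have h4 : ((((n : ℝ) + 3) ^ 2 + 12) * (W : ℝ) ^ 2 + (n + 3) * W) * (ε'' + ε₀) ≤
      ((((n : ℝ) + 3) ^ 2 + 12) * (W : ℝ) ^ 2 + (n + 3) * W) * (K * N * Rk ^ 2 * εk) :=
    mul_le_mul_of_nonneg_left hreg (by positivity)
  have h5 : ((((n : ℝ) + 3) ^ 2 + 12) * (W : ℝ) ^ 2 + (n + 3) * W) * (K * N * Rk ^ 2 * εk) <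
      (((n : ℝ) + 3) ^ 2 + 13) * D ^ 2 * (K * N * Rk ^ 2 * εk) := mul_lt_mul_of_pos_right hcoef hpos
  have h6 : (((n : ℝ) + 3) ^ 2 + 13) * D ^ 2 * (K * N * Rk ^ 2 * εk) =
      10000 * (((n : ℝ) + 3) ^ 2 + 13) * K * M ^ 2 * N * Rk ^ 4 * εk := by rw [hDdef]; ring
  linarith

end Claim

/-! ## §5 The dictionary to r12's tree `T0 lo hi τs m` (general threshold sequence) -/

section Bridge

variable {lo hi : ℕ → Site (n + 3)} {τs : ℕ → ℤ} {m : ℕ}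

/-- The trees of the consecutive pairs (each with its own threshold) are parts of `T₀`. [cite: Balaban1989LargeFieldI, p.196] -/
theorem tree_subset_T0V {i : ℕ} (him : i < m) :
    B15TreeGraph196.tree (n := n + 1) (lo i) (hi i) (lo (i + 1)) (hi (i + 1)) (τs i) ⊆
      B15TreeGraph196.T0 (n := n + 1) lo hi τs m := by
  intro b hb
  rw [B15TreeGraph196.T0, Finset.mem_union, Finset.mem_biUnion]
  exact Or.inl ⟨i, Finset.mem_range.mpr him, hb⟩

/-- The external bonds are bonds of `T₀`. [cite: Balaban1989LargeFieldI, p.196] -/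
theorem extBond_mem_T0V {i : ℕ} (him : i < m) :
    B15TreeGraph196.extBond (n := n + 1) lo i ∈ B15TreeGraph196.T0 (n := n + 1) lo hi τs m := by
  rw [B15TreeGraph196.T0, Finset.mem_union, Finset.mem_image]
  exact Or.inr ⟨i, Finset.mem_range.mpr him, rfl⟩

/-- p26's layer (a `Set`) and r12's annulus (a `Finset`) have the same sites. [cite: Balaban1989LargeFieldI, p.196] -/
theorem mem_layer_iff_mem_graphAnn {i : ℕ} {x : Site (n + 3)} :
    x ∈ layer lo hi i ↔ x ∈ B15TreeGraph196.ann (n := n + 1) (lo i) (hi i) (lo (i + 1)) (hi (i + 1)) := by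
  rw [B15TreeGraph196.mem_ann, B15TreeGraph196.mem_box, B15TreeGraph196.mem_box, layer, mem_ann_iff, mem_box_iff,
    mem_box_iff]

/-- **The bonds traversed by a contour `Γ^{i}_{yⁱ,x}` (threshold `τs i`) of layer `i` are bonds of `T₀`.** [cite: Balaban1989LargeFieldI, p.196] -/
theorem wordBonds_contour_subset_T0V {i : ℕ} (him : i < m) {x : Site (n + 3)} (hx : x ∈ layer lo hi i) :
    wordBonds (lo i) (contour (lo i) (hi i) (τs i) x) ⊆ B15TreeGraph196.T0 (n := n + 1) lo hi τs m := by
  have hxb := mem_box_iff.mp hx.1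
  rw [wordBonds_contour (fun κ => (hxb κ).1) (fun κ => (hxb κ).2)]
  intro b hb
  exact tree_subset_T0V him (B15TreeGraph196.mem_tree.mpr ⟨x, mem_layer_iff_mem_graphAnn.mp hx, hb⟩)

/-- **The bonds traversed by the chain word are bonds of `T₀`**: `chainWord i` runs through the trees of the layers `j < i` (usual
contours, present for every threshold) and the external bonds `⟨yʲ⁺¹ − e₁, yʲ⁺¹⟩`. [cite: Balaban1989LargeFieldI, p.196] -/
theorem wordBonds_chainWord_subset_T0V (hC : ChainGeomV lo hi τs m) :
    ∀ {i : ℕ}, i < m → wordBonds (lo 0) (chainWord lo i) ⊆ B15TreeGraph196.T0 (n := n + 1) lo hi τs m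
  | 0, _ => by simp [wordBonds_nil]
  | i + 1, him => by
    have him' : i < m := by omega
    rw [chainWord_succ_eq (hC.chainGeom him') (Nat.lt_succ_self i), wordBonds_append, add_disp_chainWord, wordBonds_append,
      disp_contour, show lo i + (lo (i + 1) - e i0 - lo i) = lo (i + 1) - e i0 by abel, wordBonds_cons, wordBonds_nil]
    refine Finset.union_subset (wordBonds_chainWord_subset_T0V hC him') (Finset.union_subset
      (wordBonds_contour_subset_T0V him' ((hC.chainGeom him').extEnd_mem_layer le_rfl)) ?_)
    rw [Finset.insert_empty, Finset.singleton_subset_iff, show bondOf (lo (i + 1) - e i0) ((i0 : Fin (n + 3)), true) =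
      (lo (i + 1) - e i0, (i0 : Fin (n + 3))) by simp [bondOf], ← extBond_eq]
    exact extBond_mem_T0V him

/-- **Every bond traversed by a `T₀`-path is a bond of r12's `T0 lo hi τs m`.** [cite: Balaban1989LargeFieldI, p.196] -/
theorem wordBonds_t0word_subset_T0V (hC : ChainGeomV lo hi τs m) {i : ℕ} (him : i < m) {x : Site (n + 3)}
    (hx : x ∈ layer lo hi i) :
    wordBonds (lo 0) (t0word lo hi (τs i) i x) ⊆ B15TreeGraph196.T0 (n := n + 1) lo hi τs m := by
  rw [t0word, wordBonds_append, add_disp_chainWord]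
  exact Finset.union_subset (wordBonds_chainWord_subset_T0V hC him) (wordBonds_contour_subset_T0V him hx)

variable {G : Type*} [Group G] {V' : Site (n + 3) → Fin (n + 3) → G}

/-- **p. 196 "bond variables equal to 1 for bonds belonging to the tree graph" ⇒ `T0GaugeV`**: if `V′(b) = 1` for every bond of
r12's `T0 lo hi τs m` (ANY admissible threshold sequence; the tree of `T0_isTree`), then the gauge conditions of §4 hold.
[cite: Balaban1989LargeFieldI, p.196] -/
theorem T0GaugeV.of_eq_one_on_T0 (h : ∀ b ∈ B15TreeGraph196.T0 (n := n + 1) lo hi τs m, V' b.1 b.2 = 1) :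
    T0GaugeV V' lo hi τs m where
  tree i him x hx := bondsOneAlong_of_wordBonds fun b hb => h b (wordBonds_contour_subset_T0V him hx hb)
  ext i him := by
    have hb := h _ (extBond_mem_T0V (lo := lo) (hi := hi) (τs := τs) (i := i + 1) him)
    rwa [extBond_eq] at hb

/-- … and then the gauge conditions hold along every `T₀`-path. [cite: Balaban1989LargeFieldI, p.196] -/
theorem bondsOneAlong_t0word_of_eq_one_on_T0V (hC : ChainGeomV lo hi τs m)
    (h : ∀ b ∈ B15TreeGraph196.T0 (n := n + 1) lo hi τs m, V' b.1 b.2 = 1) {i : ℕ} (him : i < m)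
    {x : Site (n + 3)} (hx : x ∈ layer lo hi i) : BondsOneAlong V' (lo 0) (t0word lo hi (τs i) i x) :=
  bondsOneAlong_of_wordBonds fun b hb => h b (wordBonds_t0word_subset_T0V hC him hx hb)

/-- **Conversely, `T0GaugeV` ⇒ `V′ = 1` on r12's `T0`**, given also `V′ = 1` on the printed *"additional bond [(y₁ − 1, y₂, …, y_d),
y]"* of `Λ = P⁰` (`extBond lo 0`, which fixes the last global gauge degree of freedom and is not met by any `T₀`-path): the two
typings of the gauge fixing on `T₀` are equivalent. [cite: Balaban1989LargeFieldI, p.196] -/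
theorem T0GaugeV.eq_one_on_T0 (hT : T0GaugeV V' lo hi τs m) (h0 : V' (lo 0 - e i0) i0 = 1) :
    ∀ b ∈ B15TreeGraph196.T0 (n := n + 1) lo hi τs m, V' b.1 b.2 = 1 := by
  intro b hb
  rw [B15TreeGraph196.T0, Finset.mem_union, Finset.mem_biUnion, Finset.mem_image] at hb
  rcases hb with ⟨i, hir, hb⟩ | ⟨i, hir, rfl⟩
  · have him := Finset.mem_range.mp hir
    obtain ⟨x, hx, hb⟩ := B15TreeGraph196.mem_tree.mp hb
    have hx' : x ∈ layer lo hi i := mem_layer_iff_mem_graphAnn.mpr hx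
    have hxb := mem_box_iff.mp hx'.1
    rw [← wordBonds_contour (fun κ => (hxb κ).1) (fun κ => (hxb κ).2)] at hb
    exact bondsOneAlong_iff_wordBonds.mp (hT.tree i him x hx') b hb
  · have him := Finset.mem_range.mp hir
    rw [extBond_eq]
    cases i with
    | zero => exact h0
    | succ i => exact hT.ext i him

end Bridge

/-! ## §6 The claim stated directly over r12's tree `T0 lo hi τs m` -/

section ClaimOnT0

variable {𝔸 : Type*} [NormedRing 𝔸] [NormOneClass 𝔸]
variable {lo hi : ℕ → Site (n + 3)} {τs : ℕ → ℤ} {m W : ℕ} {V' V₀ : Site (n + 3) → Fin (n + 3) → 𝔸ˣ} {ε'' ε₀ : ℝ}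

/-- **The hypotheses of the claim with the gauge fixing stated on r12's tree**: chain geometry, widths, `U1`-valued `V′, V₀`,
plaquette regularity of `V″ = V′V₀` and `V₀` on `𝐁₀`, and *"bond variables equal to 1 for bonds belonging to the tree graph"*
`T0 lo hi τs m` of `B15TreeGraph196` (PROVED there to be a tree, `T0_isTree`). [cite: Balaban1989LargeFieldI, p.196 (bound on V′)] -/
theorem RegHypT0V.of_eq_one_on_T0 (hC : ChainGeomV lo hi τs m) (hW : ∀ κ, hi 0 κ - lo 0 κ ≤ W)
    (hV' : ∀ x κ, V' x κ ∈ U1 𝔸) (hV₀ : ∀ x κ, V₀ x κ ∈ U1 𝔸) (hε'' : 0 ≤ ε'') (hε₀ : 0 ≤ ε₀)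
    (hP'' : B16Ineq382.PlaqSmallOn (B0 lo hi m) (mulCfg V' V₀) ε'') (hP₀ : B16Ineq382.PlaqSmallOn (B0 lo hi m) V₀ ε₀)
    (htree : ∀ b ∈ B15TreeGraph196.T0 (n := n + 1) lo hi τs m, V' b.1 b.2 = 1) :
    RegHypT0V lo hi τs m W V' V₀ ε'' ε₀ :=
  ⟨hC, hW, hV', hV₀, hε'', hε₀, hP'', hP₀, T0GaugeV.of_eq_one_on_T0 htree⟩

/-- **[IV] p. 196 for r12's `T₀` AS TYPED**: if `V′ = 1` on the bonds of `B15TreeGraph196.T0 lo hi τs m` (any admissible threshold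
sequence) and `V″ = V′V₀`, `V₀` have `ε″`-, `ε₀`-small plaquettes on `𝐁₀`, then every bond `b` with both ends in `𝐁₀` has
`‖V′(b) − 1‖ ≤ ((d² + 12)W² + dW)(ε″ + ε₀)`. [cite: Balaban1989LargeFieldI, p.196 (bound on V′)] -/
theorem norm_fluct_sub_one_le_of_eq_one_on_T0 (hC : ChainGeomV lo hi τs m) (hW : ∀ κ, hi 0 κ - lo 0 κ ≤ W)
    (hV' : ∀ x κ, V' x κ ∈ U1 𝔸) (hV₀ : ∀ x κ, V₀ x κ ∈ U1 𝔸) (hε'' : 0 ≤ ε'') (hε₀ : 0 ≤ ε₀)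
    (hP'' : B16Ineq382.PlaqSmallOn (B0 lo hi m) (mulCfg V' V₀) ε'') (hP₀ : B16Ineq382.PlaqSmallOn (B0 lo hi m) V₀ ε₀)
    (htree : ∀ b ∈ B15TreeGraph196.T0 (n := n + 1) lo hi τs m, V' b.1 b.2 = 1) {x : Site (n + 3)} {μ : Fin (n + 3)}
    (hx : x ∈ B0 lo hi m) (hx' : x + e μ ∈ B0 lo hi m) :
    ‖((V' x μ : 𝔸ˣ) : 𝔸) - 1‖ ≤ ((((n : ℝ) + 3) ^ 2 + 12) * (W : ℝ) ^ 2 + (n + 3) * W) * (ε'' + ε₀) :=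
  (RegHypT0V.of_eq_one_on_T0 hC hW hV' hV₀ hε'' hε₀ hP'' hP₀ htree).norm_fluct_sub_one_le hx hx'

/-- … and the typed leaf `IneqV196` by name, under the packaging of generation 4. [cite: Balaban1989LargeFieldI, p.196 (bound on V′)] -/
theorem ineqV196_of_eq_one_on_T0 (hC : ChainGeomV lo hi τs m) (hW : ∀ κ, hi 0 κ - lo 0 κ ≤ W)
    (hV' : ∀ x κ, V' x κ ∈ U1 𝔸) (hV₀ : ∀ x κ, V₀ x κ ∈ U1 𝔸) (hε'' : 0 ≤ ε'') (hε₀ : 0 ≤ ε₀)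
    (hP'' : B16Ineq382.PlaqSmallOn (B0 lo hi m) (mulCfg V' V₀) ε'') (hP₀ : B16Ineq382.PlaqSmallOn (B0 lo hi m) V₀ ε₀)
    (htree : ∀ b ∈ B15TreeGraph196.T0 (n := n + 1) lo hi τs m, V' b.1 b.2 = 1) {M Rk N εk K : ℝ}
    (hD : (W : ℝ) + 1 ≤ 100 * M * Rk) (hd : (n : ℝ) + 3 ≤ 100 * M * Rk) (hK : 0 < K) (hN : 1 ≤ N) (hRk : 0 < Rk)
    (hεk : 0 < εk) (hreg : ε'' + ε₀ ≤ K * N * Rk ^ 2 * εk) {x : Site (n + 3)} {μ : Fin (n + 3)}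
    (hx : x ∈ B0 lo hi m) (hx' : x + e μ ∈ B0 lo hi m) :
    B15.PrelimIntegrations.IneqV196 ‖((V' x μ : 𝔸ˣ) : 𝔸) - 1‖ (10000 * (((n : ℝ) + 3) ^ 2 + 13) * K) M N Rk εk :=
  (RegHypT0V.of_eq_one_on_T0 hC hW hV' hV₀ hε'' hε₀ hP'' hP₀ htree).ineqV196 hD hd hK hN hRk hεk hreg hx hx'

end ClaimOnT0

/-! ## §7 The tree certificate: r12's `T0_isTree` for the model instance (v1.1) -/

section TreeCertificate

variable {lo hi : ℕ → Site (n + 3)} {τs : ℕ → ℤ} {τ : ℤ} {m : ℕ}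

/-- **Dictionary**: one annulus `P₁ ∖ P₂` of the model with an admissible threshold `a` (`Geom`) and `P₁ ≠ ∅` is an admissible pair
of r12's combinatorial model (`B15TreeGraph196.Adm`: box non-empty, `P₂` strictly inside in directions 1, 2, threshold
`a ∈ [a′₁ − 1, b′₁]`). [cite: Balaban1989LargeFieldI, p.196] -/
theorem Geom.adm {lo hi lo' hi' : Site (n + 3)} (hG : Geom lo hi lo' hi' τ) (hle : lo ≤ hi) :
    B15TreeGraph196.Adm (n := n + 1) lo hi lo' hi' τ := by
  have h00 : ((0 : Fin (n + 1 + 2)) : Fin (n + 3)) = i0 := Fin.ext (by rw [i0_val]; rfl)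
  refine ⟨fun i => hle i, ?_, ?_, hG.lo_lt _, ?_, ?_⟩
  · rw [h00]; exact hG.lo_lt i0
  · rw [h00]; exact hG.lt_hi i0
  · rw [h00]; have := hG.le_tau; omega
  · rw [h00]; exact hG.tau_le

/-- **Dictionary**: a chain of the model (`ChainGeomV`: consecutive pairs admissible with their own thresholds, boxes non-empty)
is a chain of r12's combinatorial model (`B15TreeGraph196.Chain`: admissible pairs + nesting `lⁱ ≤ lⁱ⁺¹ ≤ uⁱ⁺¹ ≤ uⁱ`).
[cite: Balaban1989LargeFieldI, p.196] -/
theorem ChainGeomV.chain (hC : ChainGeomV lo hi τs m) : B15TreeGraph196.Chain (n := n + 1) m lo hi τs where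
  adm i him := (hC.geom i him).adm (hC.lo_le_hi i him.le)
  nest i him j := ⟨((hC.geom i him).lo_lt j).le, hC.lo_le_hi (i + 1) him j, ((hC.geom i him).lt_hi j).le⟩

/-- The common-threshold chain of generation 5 likewise. [cite: Balaban1989LargeFieldI, p.196] -/
theorem ChainGeom.chain (hC : ChainGeom lo hi τ m) : B15TreeGraph196.Chain (n := n + 1) m lo hi fun _ => τ :=
  hC.chainGeomV.chain

/-- **p. 196 «It is a tree graph in 𝔹₀» FOR THE MODEL INSTANCE**: under the model's geometric hypotheses the graph of r12's
`T₀ = ⋃_{i<m} T(Pⁱ, Pⁱ⁺¹) ∪ {⟨yⁱ − e₁, yⁱ⟩ : i < m}` (general threshold sequence) on the sites `𝔅₀ ∪ {y⁰ − e₁}` is a tree —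
r12's `T0_isTree` applied through the dictionary `ChainGeomV.chain`. [cite: Balaban1989LargeFieldI, p.196] -/
theorem ChainGeomV.T0_isTree (hC : ChainGeomV lo hi τs m) :
    (B15TreeGraph196.bondGraph (B15TreeGraph196.T0 (n := n + 1) lo hi τs m)
      (B15TreeGraph196.sites (n := n + 1) lo hi m)).IsTree :=
  B15TreeGraph196.T0_isTree hC.chain

/-- … with `|T₀| + 1 = |sites|`. [cite: Balaban1989LargeFieldI, p.196] -/
theorem ChainGeomV.card_T0 (hC : ChainGeomV lo hi τs m) :
    (B15TreeGraph196.T0 (n := n + 1) lo hi τs m).card + 1 = (B15TreeGraph196.sites (n := n + 1) lo hi m).card :=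
  B15TreeGraph196.card_T0 hC.chain

/-- … and exactly one bond of `T₀` per site of `𝔅₀` (verbatim *"fixing completely a gauge in this set"*).
[cite: Balaban1989LargeFieldI, p.196] -/
theorem ChainGeomV.card_T0_eq (hC : ChainGeomV lo hi τs m) :
    (B15TreeGraph196.T0 (n := n + 1) lo hi τs m).card =
      ((Finset.range m).biUnion (B15TreeGraph196.layer (n := n + 1) lo hi)).card :=
  B15TreeGraph196.card_T0_eq hC.chain

/-- **The vertex set of r12's `T₀` is `𝔅₀ ∪ {y⁰ − e₁}`** in the model's vocabulary. [cite: Balaban1989LargeFieldI, p.196] -/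
theorem mem_sites_iff {x : Site (n + 3)} :
    x ∈ B15TreeGraph196.sites (n := n + 1) lo hi m ↔ x = lo 0 - e i0 ∨ x ∈ B0 lo hi m := by
  rw [B15TreeGraph196.sites, Finset.mem_union, Finset.mem_singleton, Finset.mem_biUnion, B15TreeGraph196.outRoot,
    ← e_i0_eq_unitVec]
  refine or_congr Iff.rfl ⟨fun ⟨i, hi, hx⟩ => ⟨i, Finset.mem_range.mp hi, ?_⟩, fun ⟨i, hi, hx⟩ =>
    ⟨i, Finset.mem_range.mpr hi, ?_⟩⟩
  · rw [B15TreeGraph196.layer] at hx; exact mem_layer_iff_mem_graphAnn.mpr hx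
  · rw [B15TreeGraph196.layer]; exact mem_layer_iff_mem_graphAnn.mp hx

/-- The corner `yⁱ` of `Pⁱ` is a site of layer `i` (boxes non-empty, strict nesting). [cite: Balaban1989LargeFieldI, p.196] -/
theorem ChainGeomV.lo_mem_layer (hC : ChainGeomV lo hi τs m) {i : ℕ} (him : i < m) : lo i ∈ layer lo hi i := by
  refine ⟨mem_box_iff.mpr fun κ => ⟨le_rfl, hC.lo_le_hi i him.le κ⟩, not_mem_box_of_lt i0 ?_⟩
  exact (hC.geom i him).lo_lt i0

/-- The external bond `⟨yⁱ⁺¹ − e₁, yⁱ⁺¹⟩` of `Pⁱ⁺¹` is traversed by the chain word `chainWord (i + 1)`. [cite: Balaban1989LargeFieldI, p.196] -/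
theorem ChainGeomV.extBond_mem_wordBonds_chainWord (hC : ChainGeomV lo hi τs m) {i : ℕ} (him : i < m) :
    B15TreeGraph196.extBond (n := n + 1) lo (i + 1) ∈ wordBonds (lo 0) (chainWord lo (i + 1)) := by
  rw [chainWord_succ_eq (hC.chainGeom him) (Nat.lt_succ_self i), wordBonds_append, add_disp_chainWord, wordBonds_append,
    disp_contour, show lo i + (lo (i + 1) - e i0 - lo i) = lo (i + 1) - e i0 by abel, wordBonds_cons, wordBonds_nil,
    extBond_eq]
  refine Finset.mem_union_right _ (Finset.mem_union_right _ ?_)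
  simp [bondOf]

/-- **r12's `T₀` is COVERED by the `T₀`-paths** (general threshold sequence): a bond belongs to `T0 lo hi τs m` iff it is the
additional `Λ`-bond `⟨y⁰ − e₁, y⁰⟩` (present for `m > 0`) or it is traversed by the `T₀`-path `t0word lo hi (τs i) i x` of some site
`x` of some layer `i < m` — so the gauge function `v(x) = U(T₀-path to x)` of §4 runs over every bond of `T₀` except the `Λ`-bond
(which fixes the last global gauge degree of freedom), and over no other bond. [cite: Balaban1989LargeFieldI, p.196] -/
theorem ChainGeomV.mem_T0_iff (hC : ChainGeomV lo hi τs m) {b : Site (n + 3) × Fin (n + 3)} :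
    b ∈ B15TreeGraph196.T0 (n := n + 1) lo hi τs m ↔
      (0 < m ∧ b = (lo 0 - e i0, (i0 : Fin (n + 3)))) ∨
        ∃ i, i < m ∧ ∃ x ∈ layer lo hi i, b ∈ wordBonds (lo 0) (t0word lo hi (τs i) i x) := by
  constructor
  · intro hb
    rw [B15TreeGraph196.T0, Finset.mem_union, Finset.mem_biUnion, Finset.mem_image] at hb
    rcases hb with ⟨i, hir, hb⟩ | ⟨i, hir, rfl⟩
    · have him := Finset.mem_range.mp hir
      obtain ⟨x, hx, hb⟩ := B15TreeGraph196.mem_tree.mp hb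
      have hx' : x ∈ layer lo hi i := mem_layer_iff_mem_graphAnn.mpr hx
      have hxb := mem_box_iff.mp hx'.1
      refine Or.inr ⟨i, him, x, hx', ?_⟩
      rw [t0word, wordBonds_append, add_disp_chainWord, wordBonds_contour (fun κ => (hxb κ).1) (fun κ => (hxb κ).2)]
      exact Finset.mem_union_right _ hb
    · have him := Finset.mem_range.mp hir
      cases i with
      | zero => exact Or.inl ⟨him, extBond_eq lo 0⟩
      | succ j =>
        refine Or.inr ⟨j + 1, him, lo (j + 1), hC.lo_mem_layer him, ?_⟩
        rw [t0word, wordBonds_append]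
        exact Finset.mem_union_left _ (hC.extBond_mem_wordBonds_chainWord (by omega))
  · rintro (⟨hm, rfl⟩ | ⟨i, him, x, hx, hb⟩)
    · rw [← extBond_eq]; exact extBond_mem_T0V hm
    · exact wordBonds_t0word_subset_T0V hC him hx hb

end TreeCertificate

end Literature.MathematicalPhysics.QuantumFieldTheory.Balaban1983to89.B15TreeGauge196
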